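import Mathlib.Analysis.SpecialFunctions.Gaussian.GaussianIntegral
import Mathlib.MeasureTheory.Integral.IntegralEqImproper
import Literature.Analysis.FluidPDE.SteadyStrainedNS
import HarnessLib

/-!
# The Burgers vortex layer: a strained shear layer on `ℝ³`

Analysis/FluidPDE definitions file (work item `defn-BurgersVortexInStrain`, part (b); wanted by
route `FrozenK41` of `AnomalousDissipation`). In the PLANE strain `U_s(x) = (−γx₀, 0, γx₂)`
(compression along `x₀`, stretching along the axis `x₂`, neutral direction `x₁`) the
unidirectional shear `v(x) = (0, V(x₀), 0)` is an exact steady solution of the Navier–Stokes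
equations iff `νV'' = −γ x₀ V'`, i.e. `V' ∝ exp(−γx₀²/(2ν))`; with velocity jump `ΔU` across the
layer this is the **Burgers vortex layer** (Burgers 1948; the `λ → 1` end of Gallay–Wayne's strain
(1.1); "stretched vortex layers", Gallay–Maekawa 2016, Introduction)

  `V(s) = (ΔU/2) erf(s √(γ/2ν)) = (ΔU/√π) ∫₀^{s√(γ/2ν)} e^{−t²} dt`,

with vorticity `ω = V'(x₀) e_z = ΔU (γ/2πν)^{1/2} exp(−γx₀²/2ν) e_z`, a Gaussian of thickness
`δ = (ν/γ)^{1/2}`, and viscous dissipation per unit area of the layer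

  `ν ∫_ℝ V'(s)² ds = ΔU² (γν)^{1/2} / (2√π)`  (`≍ ΔU²(νγ)^{1/2}`, PROVED below).

## Contents

* `burgersLayerProfile γ ν ΔU s = (ΔU/√π) ∫₀^{√(γ/(2ν)) s} e^{−t²} dt` (Mathlib has no `erf`;
  the Gaussian primitive is written as an interval integral), `burgersLayerVelocity`,
  `burgersLayer = planeStrain γ + burgersLayerVelocity`, `burgersLayerThickness γ ν = (ν/γ)^{1/2}`;
* proved: `V(0) = 0`, oddness, the derivative `V'(s) = ΔU (γ/2πν)^{1/2} e^{−γs²/2ν}`, smoothness,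
  the limits `V(±∞) = ±ΔU/2` (so the jump across the layer is `ΔU`), and the dissipation
  identity `ν ∫ V'² = ΔU²(γν)^{1/2}/(2√π)` (`burgersLayer_dissipation`).

The exact-solution property `IsSteadyNSInStrain ν (planeStrain γ) (burgersLayerVelocity γ ν ΔU)`
is proved in `BurgersVortexLayerSteady`.

## References

* J. M. Burgers, *A mathematical model illustrating the theory of turbulence*, Adv. Appl. Mech. 1
  (1948) 171–199 (vortex sheet/layer in strain).
* Th. Gallay, C. E. Wayne, arXiv:math/0503353, (1.1) (strain rates; `λ = 1` is plane strain). [GallayWayne2006]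
* Th. Gallay, Y. Maekawa, arXiv:1610.08384, §1 (Burgers' model; stretched layers). [GallayMaekawa2016]
-/

noncomputable section

open Set Function Filter Topology WithLp MeasureTheory intervalIntegral
open scoped ContDiff

namespace Literature.Analysis.FluidPDE

/-- Local notation for physical space `ℝ³ = EuclideanSpace ℝ (Fin 3)`. -/
local notation "ℝ³" => EuclideanSpace ℝ (Fin 3)

/-! ### The erf profile -/

/-- The inverse length `κ = (γ/(2ν))^{1/2}` of the layer profile (`0` as junk value when
`γ/(2ν) < 0`). [folklore] -/
def burgersLayerRate (γ ν : ℝ) : ℝ :=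
  Real.sqrt (γ / (2 * ν))

/-- The **Burgers layer profile** `V(s) = (ΔU/√π) ∫₀^{κ s} e^{−t²} dt = (ΔU/2) erf(κ s)`,
`κ = (γ/2ν)^{1/2}`: the unique (up to constants) solution of `νV'' = −γ s V'` with `V(0) = 0` and
jump `V(+∞) − V(−∞) = ΔU` (Burgers 1948). Mathlib has no `erf`, so the Gaussian primitive is an
interval integral. [folklore] -/
def burgersLayerProfile (γ ν ΔU : ℝ) (s : ℝ) : ℝ :=
  ΔU / Real.sqrt Real.pi * ∫ t in (0 : ℝ)..(burgersLayerRate γ ν * s), Real.exp (-t ^ 2)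

/-- The layer perturbation velocity `v(x) = (0, V(x₀), 0)`: a shear in the neutral direction
`x₁`, varying across the compressive direction `x₀`. [folklore] -/
def burgersLayerVelocity (γ ν ΔU : ℝ) (x : ℝ³) : ℝ³ :=
  toLp 2 ![0, burgersLayerProfile γ ν ΔU (x 0), 0]

/-- The **Burgers vortex layer** `u = U_s + v` in the plane strain `U_s = (−γx₀, 0, γx₂)`
(Burgers 1948). [folklore] -/
def burgersLayer (γ ν ΔU : ℝ) : ℝ³ → ℝ³ :=
  planeStrain γ + burgersLayerVelocity γ ν ΔU

/-- The **layer thickness** `δ = (ν/γ)^{1/2}` (the Gaussian vorticity profile is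
`∝ exp(−x₀²/(2δ²))`); the same length as the Burgers core radius `burgersCoreRadius γ ν` of
`BurgersVortex`. [folklore] -/
def burgersLayerThickness (γ ν : ℝ) : ℝ :=
  Real.sqrt (ν / γ)

/-- `δ² = ν/γ` for `ν/γ ≥ 0`. [folklore] -/
theorem burgersLayerThickness_sq {γ ν : ℝ} (h : 0 ≤ ν / γ) : burgersLayerThickness γ ν ^ 2 = ν / γ :=
  Real.sq_sqrt h

/-- Components of the layer velocity. [folklore] -/
@[simp] theorem burgersLayerVelocity_apply_zero (γ ν ΔU : ℝ) (x : ℝ³) :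
    burgersLayerVelocity γ ν ΔU x 0 = 0 := rfl

/-- Components of the layer velocity. [folklore] -/
@[simp] theorem burgersLayerVelocity_apply_one (γ ν ΔU : ℝ) (x : ℝ³) :
    burgersLayerVelocity γ ν ΔU x 1 = burgersLayerProfile γ ν ΔU (x 0) := rfl

/-- Components of the layer velocity. [folklore] -/
@[simp] theorem burgersLayerVelocity_apply_two (γ ν ΔU : ℝ) (x : ℝ³) :
    burgersLayerVelocity γ ν ΔU x 2 = 0 := rfl

/-- `κ² = γ/(2ν)` when `γ/(2ν) ≥ 0`. [folklore] -/
theorem burgersLayerRate_sq {γ ν : ℝ} (h : 0 ≤ γ / (2 * ν)) : burgersLayerRate γ ν ^ 2 = γ / (2 * ν) :=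
  Real.sq_sqrt h

/-- `κ > 0` for `γ, ν > 0`. [folklore] -/
theorem burgersLayerRate_pos {γ ν : ℝ} (hγ : 0 < γ) (hν : 0 < ν) : 0 < burgersLayerRate γ ν :=
  Real.sqrt_pos.2 (by positivity)

/-- `V(0) = 0`: the profile vanishes at the centre of the layer. [folklore] -/
@[simp] theorem burgersLayerProfile_zero (γ ν ΔU : ℝ) : burgersLayerProfile γ ν ΔU 0 = 0 := by
  simp [burgersLayerProfile]

/-- The profile is odd: `V(−s) = −V(s)`. [folklore] -/
theorem burgersLayerProfile_neg (γ ν ΔU s : ℝ) :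
    burgersLayerProfile γ ν ΔU (-s) = -burgersLayerProfile γ ν ΔU s := by
  simp only [burgersLayerProfile, mul_neg]
  have h : ∫ t in (0 : ℝ)..-(burgersLayerRate γ ν * s), Real.exp (-t ^ 2) =
      -∫ t in (0 : ℝ)..(burgersLayerRate γ ν * s), Real.exp (-t ^ 2) := by
    have := intervalIntegral.integral_comp_neg (a := (0 : ℝ)) (b := -(burgersLayerRate γ ν * s))
      (f := fun u : ℝ => Real.exp (-u ^ 2))
    simp only [neg_neg, neg_zero, neg_sq] at this
    rw [this, intervalIntegral.integral_symm (burgersLayerRate γ ν * s) 0, neg_neg]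
  rw [h, mul_neg]

/-- The Gaussian `t ↦ e^{−t²}` is continuous. [folklore] -/
theorem continuous_exp_neg_sq : Continuous fun t : ℝ => Real.exp (-t ^ 2) := by
  fun_prop

/-- **The derivative of the profile**: `V'(s) = (ΔU/√π) κ e^{−(κs)²}`, `κ = (γ/2ν)^{1/2}`
(fundamental theorem of calculus and the chain rule). [folklore] -/
theorem hasDerivAt_burgersLayerProfile (γ ν ΔU s : ℝ) :
    HasDerivAt (burgersLayerProfile γ ν ΔU)
      (ΔU / Real.sqrt Real.pi *
        (burgersLayerRate γ ν * Real.exp (-(burgersLayerRate γ ν * s) ^ 2))) s := by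
  unfold burgersLayerProfile
  refine HasDerivAt.const_mul _ ?_
  have hF : HasDerivAt (fun u => ∫ t in (0 : ℝ)..u, Real.exp (-t ^ 2))
      (Real.exp (-(burgersLayerRate γ ν * s) ^ 2)) (burgersLayerRate γ ν * s) :=
    (continuous_exp_neg_sq.integral_hasStrictDerivAt 0 _).hasDerivAt
  have hlin : HasDerivAt (fun u : ℝ => burgersLayerRate γ ν * u) (burgersLayerRate γ ν) s := by
    simpa using (hasDerivAt_id s).const_mul (burgersLayerRate γ ν)
  exact (hF.comp s hlin).congr_deriv (mul_comm _ _)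

/-- The derivative of the profile as a Gaussian in `s`: `V'(s) = (ΔU/√π) κ e^{−γs²/(2ν)}` for
`γ/(2ν) ≥ 0`. [folklore] -/
theorem deriv_burgersLayerProfile {γ ν : ℝ} (h : 0 ≤ γ / (2 * ν)) (ΔU s : ℝ) :
    deriv (burgersLayerProfile γ ν ΔU) s =
      ΔU / Real.sqrt Real.pi * burgersLayerRate γ ν * Real.exp (-(γ / (2 * ν) * s ^ 2)) := by
  rw [(hasDerivAt_burgersLayerProfile γ ν ΔU s).deriv, mul_pow, burgersLayerRate_sq h]
  ring_nf

/-- The profile is differentiable. [folklore] -/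
theorem differentiable_burgersLayerProfile (γ ν ΔU : ℝ) :
    Differentiable ℝ (burgersLayerProfile γ ν ΔU) :=
  fun s => (hasDerivAt_burgersLayerProfile γ ν ΔU s).differentiableAt

/-- **The profile is smooth.** [folklore] -/
theorem contDiff_burgersLayerProfile (γ ν ΔU : ℝ) : ContDiff ℝ ∞ (burgersLayerProfile γ ν ΔU) := by
  have hd : deriv (burgersLayerProfile γ ν ΔU) = fun s =>
      ΔU / Real.sqrt Real.pi *
        (burgersLayerRate γ ν * Real.exp (-(burgersLayerRate γ ν * s) ^ 2)) :=
    funext fun s => (hasDerivAt_burgersLayerProfile γ ν ΔU s).deriv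
  rw [contDiff_infty_iff_deriv, hd]
  refine ⟨differentiable_burgersLayerProfile γ ν ΔU, ?_⟩
  exact contDiff_const.mul (contDiff_const.mul
    (Real.contDiff_exp.comp ((contDiff_const.mul contDiff_id).pow 2).neg))

/-- The layer velocity field is smooth on `ℝ³`. [folklore] -/
theorem contDiff_burgersLayerVelocity (γ ν ΔU : ℝ) : ContDiff ℝ ∞ (burgersLayerVelocity γ ν ΔU) := by
  rw [contDiff_piLp]
  intro i
  fin_cases i
  · exact contDiff_const
  · exact (contDiff_burgersLayerProfile γ ν ΔU).comp (contDiff_piLp_apply (p := 2))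
  · exact contDiff_const

/-- The Burgers layer is a smooth vector field. [folklore] -/
theorem contDiff_burgersLayer (γ ν ΔU : ℝ) : ContDiff ℝ ∞ (burgersLayer γ ν ΔU) :=
  (contDiff_linearStrain _ _ _).add (contDiff_burgersLayerVelocity γ ν ΔU)

/-! ### The jump across the layer -/

/-- Half the Gaussian integral: `∫₀^∞ e^{−t²} dt = √π/2` (Mathlib `integral_gaussian_Ioi`). [folklore] -/
theorem integral_Ioi_exp_neg_sq : ∫ t in Ioi (0 : ℝ), Real.exp (-t ^ 2) = Real.sqrt Real.pi / 2 := by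
  have := integral_gaussian_Ioi 1
  simpa using this

/-- **The limit `V(+∞) = ΔU/2`** for `γ, ν > 0`. [folklore] -/
theorem tendsto_burgersLayerProfile_atTop {γ ν : ℝ} (hγ : 0 < γ) (hν : 0 < ν) (ΔU : ℝ) :
    Tendsto (burgersLayerProfile γ ν ΔU) atTop (𝓝 (ΔU / 2)) := by
  have hκ := burgersLayerRate_pos hγ hν
  have hint : IntegrableOn (fun t : ℝ => Real.exp (-t ^ 2)) (Ioi 0) := by
    have := (integrable_exp_neg_mul_sq (b := 1) one_pos).integrableOn (s := Ioi 0)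
    simpa using this
  have hlim := intervalIntegral_tendsto_integral_Ioi 0 hint
    (Filter.Tendsto.const_mul_atTop hκ tendsto_id)
  rw [integral_Ioi_exp_neg_sq] at hlim
  have := hlim.const_mul (ΔU / Real.sqrt Real.pi)
  have hπ : Real.sqrt Real.pi ≠ 0 := (Real.sqrt_pos.2 Real.pi_pos).ne'
  rw [show ΔU / Real.sqrt Real.pi * (Real.sqrt Real.pi / 2) = ΔU / 2 by field_simp] at this
  exact this

/-- **The limit `V(−∞) = −ΔU/2`** for `γ, ν > 0`; hence the velocity jump across the layer is
`V(+∞) − V(−∞) = ΔU`. [folklore] -/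
theorem tendsto_burgersLayerProfile_atBot {γ ν : ℝ} (hγ : 0 < γ) (hν : 0 < ν) (ΔU : ℝ) :
    Tendsto (burgersLayerProfile γ ν ΔU) atBot (𝓝 (-(ΔU / 2))) := by
  have h := (tendsto_burgersLayerProfile_atTop hγ hν ΔU).comp tendsto_neg_atBot_atTop
  have heq : burgersLayerProfile γ ν ΔU ∘ Neg.neg = fun s => -burgersLayerProfile γ ν ΔU s := by
    funext s; exact burgersLayerProfile_neg γ ν ΔU s
  rw [heq] at h
  simpa using h.neg

/-! ### Dissipation per unit area -/

/-- The squared profile derivative is a Gaussian: `V'(s)² = (ΔU²/π) κ² e^{−(γ/ν) s²}` for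
`γ/(2ν) ≥ 0`. [folklore] -/
theorem deriv_burgersLayerProfile_sq {γ ν : ℝ} (h : 0 ≤ γ / (2 * ν)) (ΔU s : ℝ) :
    deriv (burgersLayerProfile γ ν ΔU) s ^ 2 =
      ΔU ^ 2 / Real.pi * (γ / (2 * ν)) * Real.exp (-(γ / ν) * s ^ 2) := by
  rw [deriv_burgersLayerProfile h]
  have hπ : Real.sqrt Real.pi ^ 2 = Real.pi := Real.sq_sqrt Real.pi_pos.le
  have hκ : burgersLayerRate γ ν ^ 2 = γ / (2 * ν) := burgersLayerRate_sq h
  have he : Real.exp (-(γ / (2 * ν) * s ^ 2)) ^ 2 = Real.exp (-(γ / ν) * s ^ 2) := by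
    rw [sq, ← Real.exp_add]; congr 1; ring
  rw [mul_pow, mul_pow, div_pow, hπ, hκ, he]

/-- **Dissipation per unit area of the Burgers layer** (`γ, ν > 0`): the viscous dissipation of
the shear, integrated across the layer, is
`ν ∫_ℝ V'(s)² ds = ΔU² (γν)^{1/2} / (2√π)` — of order `ΔU²(νγ)^{1/2}`, independent of the layer's
position and proportional to the square of the velocity jump (Burgers 1948; the layer analogue of
the `ν`-independent tube dissipation `γΓ²/(8π)`). Here `V' = deriv (burgersLayerProfile γ ν ΔU)`
is the only nonzero velocity gradient of the perturbation `v = (0, V(x₀), 0)`. [folklore] -/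
theorem burgersLayer_dissipation {γ ν : ℝ} (hγ : 0 < γ) (hν : 0 < ν) (ΔU : ℝ) :
    ν * ∫ s, deriv (burgersLayerProfile γ ν ΔU) s ^ 2 =
      ΔU ^ 2 * Real.sqrt (γ * ν) / (2 * Real.sqrt Real.pi) := by
  have h : 0 ≤ γ / (2 * ν) := by positivity
  simp_rw [deriv_burgersLayerProfile_sq h]
  rw [MeasureTheory.integral_const_mul, integral_gaussian (γ / ν)]
  -- `ν · ΔU²/π · γ/(2ν) · √(π/(γ/ν)) = ΔU² √(γν)/(2√π)`: write `γ = a², ν = b², π = p²`.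
  obtain ⟨a, ha, rfl⟩ : ∃ a, 0 < a ∧ a ^ 2 = γ := ⟨Real.sqrt γ, Real.sqrt_pos.2 hγ, Real.sq_sqrt hγ.le⟩
  obtain ⟨b, hb, rfl⟩ : ∃ b, 0 < b ∧ b ^ 2 = ν := ⟨Real.sqrt ν, Real.sqrt_pos.2 hν, Real.sq_sqrt hν.le⟩
  obtain ⟨p, hp, hp2⟩ : ∃ p, 0 < p ∧ p ^ 2 = Real.pi :=
    ⟨Real.sqrt Real.pi, Real.sqrt_pos.2 Real.pi_pos, Real.sq_sqrt Real.pi_pos.le⟩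
  rw [← hp2, show p ^ 2 / (a ^ 2 / b ^ 2) = (p * b / a) ^ 2 by field_simp,
    show a ^ 2 * b ^ 2 = (a * b) ^ 2 by ring,
    Real.sqrt_sq (by positivity), Real.sqrt_sq (by positivity), Real.sqrt_sq hp.le]
  field_simp

end Literature.Analysis.FluidPDE
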